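import Summits.Ventures.PercRepro.C025ProfileStagedRule

/-!
# THE ROW `(3,4)` — (Dem) EXACT, (Cap) BY CONSTRUCTION MODULO THE RIGID BOUND, THE ROW MODULO `RigidBound` (night-3 g12)
`proofs/NIGHT3-G12-STAGED.md` §2–§3. **(Dem)** `dem_wN`: a rank-`3` set `B` collects `Σ_{x∈F} (rb B x + take B x) + Σ_x Σ_{y∈T} ovf B x/|T|
= Σ_x rb B x + j_B ≥ f_B + j_B = ρ(E∖B)` (the coloop lemma `sum_rb_ge`), no hypothesis on `M`. **(Cap)**: a rank-`4` set `S` receives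
exactly `rigid S + Σ_{x ∈ dcol S} take (S∖x) x` (`sum_wStaged_eq`) and each `take` is at most the allowance `max 0 (4 − rigid S)/#dcol S`,
so the load is `≤ max (rigid S) 4` — (Cap) holds as soon as `rigid S ≤ 4` (`cap_wN_of_rigid`). Hence, by the double count
`profileIneq_of_cert`, **`profileIneq_three_four_of_rigid : RigidBound M → Profile.ProfileIneq M 3 4`** for EVERY finite matroid and
the Hall form `hallIneq_three_four_of_rigid`, where `RigidBound M := ∀ S, ρ(S) = 4 → rigid S ≤ 4` is the one open claim of the row
(0 violations on 8,681 lab matroids of ranks `5 … 7` on `≤ 12` points and on the full `≤ 9` catalogue, kit j242232; tight at `|S| = 5`).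
-/
open scoped Matroid
namespace PercRepro
open Set Finset ThmH
namespace Staged
variable {α : Type} [DecidableEq α] {M : Matroid α} [M.Finite]

/-- `C(p+3,4)/C(p+3,3) = p/4`. -/
theorem choose_ratio_three_four (p : ℕ) :
    (Nat.choose (p + 3) 4 : ℚ) / (Nat.choose (p + 3) 3 : ℚ) = (p : ℚ) / 4 := by
  have h := Nat.choose_succ_right_eq (p + 3) 3
  rw [show p + 3 - 3 = p by omega] at h
  have hpos : (0 : ℚ) < Nat.choose (p + 3) 3 := by exact_mod_cast Nat.choose_pos (by omega)
  rw [div_eq_div_iff hpos.ne' (by norm_num : (4 : ℚ) ≠ 0)]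
  have h' : ((Nat.choose (p + 3) 4 * 4 : ℕ) : ℚ) = ((Nat.choose (p + 3) 3 * p : ℕ) : ℚ) := by rw [h]
  push_cast at h'
  linarith

/-- The price at `(3, 4)` is `[4 ≤ ρ(E∖B)] · ρ(E∖B)/4`. -/
theorem price_three_four_eq (B : Finset α) :
    Profile.price M 3 4 B = if 4 ≤ crk M B then (crk M B : ℚ) / 4 else 0 := by
  have hfin : M.eRk ((gr M \ B : Finset α) : Set α) ≠ ⊤ := eRk_ne_top _
  unfold Profile.price crk
  rw [← ENat.coe_toNat hfin, ENat.toNat_coe]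
  by_cases h : 4 ≤ (M.eRk ((gr M \ B : Finset α) : Set α)).toNat
  · rw [if_pos (by exact_mod_cast h), if_pos h, choose_ratio_three_four]
  · rw [if_neg (by exact_mod_cast h), if_neg h]

omit [DecidableEq α] [M.Finite] in
/-- `rkN X ≤ |X|`. -/
theorem rkN_le_card (X : Finset α) : rkN M X ≤ X.card := by
  unfold rkN
  have h := M.eRk_le_encard (X : Set α)
  rw [Set.encard_coe_eq_coe_finsetCard] at h
  have := ENat.toNat_le_toNat h (by exact_mod_cast ENat.coe_ne_top _)
  simpa using this

omit [DecidableEq α] in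
/-- `rkN` is monotone. -/
theorem rkN_mono {X Y : Finset α} (h : X ⊆ Y) : rkN M X ≤ rkN M Y := by
  unfold rkN
  exact ENat.toNat_le_toNat (M.eRk_mono (by exact_mod_cast h)) (eRk_ne_top Y)

omit [DecidableEq α] in
/-- `ρ(cl B) = ρ(B)` for the finset closure. -/
theorem rkN_clF (B : Finset α) : rkN M (clF M B) = rkN M B := by
  unfold rkN
  rw [coe_clF, M.eRk_closure_eq]

/-- `f_B ≤ ρ(E∖B)` for `B ⊆ gr M`. -/
theorem fB_le_crk {B : Finset α} (hB : B ⊆ gr M) : fB M B ≤ crk M B := by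
  have hsub : gr M \ clF M B ⊆ gr M \ B := by
    intro x hx
    rw [Finset.mem_sdiff] at hx ⊢
    exact ⟨hx.1, fun h => hx.2 (subset_clF_self hB h)⟩
  exact rkN_mono hsub

/-- A demanding `B` has a nonempty `F_B`. -/
theorem outer_nonempty {B : Finset α} (hB : rkN M B = 3) (hd : 4 ≤ crk M B) : (outer M B).Nonempty := by
  rw [Finset.nonempty_iff_ne_empty]
  intro hE
  unfold outer at hE
  have hsub : gr M \ B ⊆ clF M B := by
    intro x hx
    by_contra hxc
    have : x ∈ gr M \ clF M B := Finset.mem_sdiff.mpr ⟨(Finset.mem_sdiff.mp hx).1, hxc⟩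
    rw [hE] at this
    exact Finset.notMem_empty _ this
  have h1 : crk M B ≤ rkN M (clF M B) := rkN_mono hsub
  rw [rkN_clF, hB] at h1
  omega

/-- The coloop lemma: `Σ_{x ∈ F_B} rb B x ≥ f_B`. -/
theorem sum_rb_ge (B : Finset α) : (fB M B : ℚ) ≤ ∑ x ∈ outer M B, rb M B x := by
  set F := outer M B with hF
  have hfle : fB M B ≤ F.card := rkN_le_card F
  rcases Nat.lt_or_ge (fB M B) F.card with hlt | hge
  · -- every point pays at least f/(f+1), and there are ≥ f+1 of them
    have hterm : ∀ x ∈ F, (fB M B : ℚ) / ((fB M B : ℚ) + 1) ≤ rb M B x := by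
      intro x _
      unfold rb
      split_ifs
      · rw [div_le_one (by positivity)]; linarith
      · exact le_rfl
    calc (fB M B : ℚ) = ((fB M B : ℚ) + 1) * ((fB M B : ℚ) / ((fB M B : ℚ) + 1)) := by
          field_simp
      _ ≤ (F.card : ℚ) * ((fB M B : ℚ) / ((fB M B : ℚ) + 1)) := by
          apply mul_le_mul_of_nonneg_right _ (by positivity)
          exact_mod_cast hlt
      _ = ∑ _x ∈ F, (fB M B : ℚ) / ((fB M B : ℚ) + 1) := by
          rw [Finset.sum_const, nsmul_eq_mul]
      _ ≤ ∑ x ∈ F, rb M B x := Finset.sum_le_sum hterm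
  · -- |F| = f: every point is a coloop of F and pays 1
    have heq : F.card = fB M B := le_antisymm hge hfle
    have hterm : ∀ x ∈ F, rb M B x = 1 := by
      intro x hx
      unfold rb
      rw [if_pos]
      have h1 : rkN M (F.erase x) ≤ (F.erase x).card := rkN_le_card _
      rw [Finset.card_erase_of_mem hx] at h1
      have hpos : 0 < F.card := Finset.card_pos.mpr ⟨x, hx⟩
      show rkN M (F.erase x) < fB M B
      omega
    rw [Finset.sum_congr rfl hterm, Finset.sum_const, nsmul_eq_mul, mul_one, heq]

/-- `x ∈ F_B` lies in the ground set and outside `cl B` (hence outside `B` when `B ⊆ gr M`). -/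
theorem mem_outer {B : Finset α} {x : α} : x ∈ outer M B ↔ x ∈ gr M ∧ x ∉ clF M B := Finset.mem_sdiff

/-- `y ∈ T_B` lies in `cl B` and outside `B`. -/
theorem mem_inner {B : Finset α} {y : α} : y ∈ inner M B ↔ y ∈ clF M B ∧ y ∉ B := Finset.mem_sdiff

/-- A one-point extension `B ∪ {x}`, `x ∈ F_B`, of a rank-`3` set `B ⊆ gr M` has rank `4`. -/
theorem insert_mem_levelSet {B : Finset α} (hBg : B ⊆ gr M) (hB : rkN M B = 3) {x : α} (hx : x ∈ outer M B) :
    insert x B ∈ Shadow.levelSet M 4 := by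
  rw [mem_outer] at hx
  rw [Profile.mem_levelSet]
  refine ⟨Finset.insert_subset hx.1 hBg, ?_⟩
  rw [Finset.coe_insert, M.eRk_insert_eq_add_one, rkN_eq_iff.mp hB]
  · rfl
  · rw [Set.mem_sdiff, ← coe_gr, ← coe_clF]
    exact ⟨by exact_mod_cast hx.1, by exact_mod_cast hx.2⟩

/-- An `Ls`-set `B ∪ {y, x}`, `y ∈ T_B`, `x ∈ F_B`, of a rank-`3` set `B ⊆ gr M` has rank `4`. -/
theorem insert_insert_mem_levelSet {B : Finset α} (hBg : B ⊆ gr M) (hB : rkN M B = 3) {y x : α}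
    (hy : y ∈ inner M B) (hx : x ∈ outer M B) : insert y (insert x B) ∈ Shadow.levelSet M 4 := by
  have h1 := insert_mem_levelSet hBg hB hx
  rw [Profile.mem_levelSet] at h1 ⊢
  rw [mem_inner] at hy
  have hyg : y ∈ gr M := clF_subset_gr B hy.1
  refine ⟨Finset.insert_subset hyg h1.1, ?_⟩
  have hycl : (y : α) ∈ M.closure ((insert x B : Finset α) : Set α) := by
    have : y ∈ M.closure (B : Set α) := by rw [← coe_clF]; exact_mod_cast hy.1
    exact M.closure_subset_closure (by rw [Finset.coe_insert]; exact Set.subset_insert _ _) this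
  apply le_antisymm
  · calc M.eRk ((insert y (insert x B) : Finset α) : Set α)
        ≤ M.eRk (M.closure ((insert x B : Finset α) : Set α)) := by
          apply M.eRk_mono
          rw [Finset.coe_insert]
          exact Set.insert_subset hycl (M.subset_closure _ (by rw [← coe_gr]; exact_mod_cast h1.1))
      _ = (4 : ℕ) := by rw [M.eRk_closure_eq, h1.2]
  · rw [← h1.2]
    apply M.eRk_mono
    simp only [Finset.coe_insert]
    exact Set.subset_insert _ _

/-- When the plane of `B` has no extra point, the excess `j_B` vanishes. -/
theorem jB_eq_zero_of_inner_empty {B : Finset α} (hBg : B ⊆ gr M) (h : inner M B = ∅) : jB M B = 0 := by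
  have hcl : clF M B = B := by
    apply le_antisymm
    · intro z hz
      by_contra hzB
      have : z ∈ inner M B := mem_inner.mpr ⟨hz, hzB⟩
      rw [h] at this; exact Finset.notMem_empty _ this
    · exact subset_clF_self hBg
  unfold jB fB outer crk
  rw [hcl]
  show crk M B - rkN M (gr M \ B) = 0
  unfold crk rkN
  omega

/-- The overflow vanishes when the plane of `B` has no extra point. -/
theorem ovf_eq_zero_of_inner_empty {B : Finset α} (hBg : B ⊆ gr M) (h : inner M B = ∅) (x : α) :
    ovf M B x = 0 := by
  have hj : jsh M B = 0 := by unfold jsh; rw [jB_eq_zero_of_inner_empty hBg h]; simp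
  unfold ovf take
  rw [hj]
  have := allow_nonneg (M := M) (insert x B)
  rw [min_eq_left this]
  ring

/-- **(Dem) by construction**: every rank-`3` set receives at least its price from `wN`. -/
theorem dem_wN {B : Finset α} (hB : B ∈ Profile.Rq M 3) :
    Profile.price M 3 4 B ≤ ∑ S ∈ (Shadow.levelSet M 4).filter (fun S => B ⊆ S), wN M B S := by
  rw [price_three_four_eq]
  split_ifs with hd
  swap
  · exact Finset.sum_nonneg (fun S _ => wN_nonneg B S)
  rw [Profile.mem_Rq] at hB
  have hBg : B ⊆ gr M := hB.1
  have hB3 : rkN M B = 3 := rkN_eq_iff.mpr hB.2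
  unfold wN
  rw [← Finset.sum_div]
  apply div_le_div_of_nonneg_right _ (by norm_num)
  -- the two families of supersets
  set rng := (Shadow.levelSet M 4).filter (fun S => B ⊆ S) with hrng
  set img1 := (outer M B).image (fun x => insert x B) with himg1
  set img2 := ((inner M B) ×ˢ (outer M B)).image (fun yx => insert yx.1 (insert yx.2 B)) with himg2
  have hsub1 : img1 ⊆ rng := by
    intro S hS
    rw [himg1, Finset.mem_image] at hS
    obtain ⟨x, hx, rfl⟩ := hS
    rw [hrng, Finset.mem_filter]
    exact ⟨insert_mem_levelSet hBg hB3 hx, Finset.subset_insert _ _⟩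
  have hsub2 : img2 ⊆ rng := by
    intro S hS
    rw [himg2, Finset.mem_image] at hS
    obtain ⟨yx, hyx, rfl⟩ := hS
    rw [Finset.mem_product] at hyx
    rw [hrng, Finset.mem_filter]
    exact ⟨insert_insert_mem_levelSet hBg hB3 hyx.1 hyx.2,
      (Finset.subset_insert _ _).trans (Finset.subset_insert _ _)⟩
  have hdisj : Disjoint img1 img2 := by
    rw [Finset.disjoint_left]
    intro S h1 h2
    rw [himg1, Finset.mem_image] at h1
    rw [himg2, Finset.mem_image] at h2
    obtain ⟨x, hx, rfl⟩ := h1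
    obtain ⟨yx, hyx, hEq⟩ := h2
    rw [Finset.mem_product, mem_inner, mem_outer] at hyx
    have hxB : x ∉ B := fun h => (mem_outer.mp hx).2 (subset_clF_self hBg h)
    have hx2B : yx.2 ∉ B := fun h => hyx.2.2 (subset_clF_self hBg h)
    have hy2 : yx.1 ∉ insert yx.2 B := by
      rw [Finset.mem_insert]; push Not
      exact ⟨fun h => hyx.2.2 (h ▸ hyx.1.1), hyx.1.2⟩
    have hc1 := congrArg Finset.card hEq
    rw [Finset.card_insert_of_notMem hy2, Finset.card_insert_of_notMem hx2B,
      Finset.card_insert_of_notMem hxB] at hc1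
    omega
  have hinj1 : ∀ x ∈ outer M B, ∀ x' ∈ outer M B, insert x B = insert x' B → x = x' := by
    intro x hx x' hx' hEq
    have hxB : x ∉ B := fun h => (mem_outer.mp hx).2 (subset_clF_self hBg h)
    have : x ∈ insert x' B := hEq ▸ Finset.mem_insert_self x B
    rw [Finset.mem_insert] at this
    rcases this with h | h
    · exact h
    · exact absurd h hxB
  have hinj2 : ∀ yx ∈ (inner M B) ×ˢ (outer M B), ∀ yx' ∈ (inner M B) ×ˢ (outer M B),
      insert yx.1 (insert yx.2 B) = insert yx'.1 (insert yx'.2 B) → yx = yx' := by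
    intro yx hyx yx' hyx' hEq
    rw [Finset.mem_product, mem_inner, mem_outer] at hyx hyx'
    have key : ∀ (a b : α × α), a.1 ∈ clF M B ∧ a.1 ∉ B → a.2 ∈ gr M ∧ a.2 ∉ clF M B →
        b.1 ∈ clF M B ∧ b.1 ∉ B → b.2 ∈ gr M ∧ b.2 ∉ clF M B →
        insert a.1 (insert a.2 B) = insert b.1 (insert b.2 B) → a.1 = b.1 ∧ a.2 = b.2 := by
      intro a b ha1 ha2 hb1 hb2 hE
      have hb1m : b.1 ∈ insert a.1 (insert a.2 B) := hE ▸ Finset.mem_insert_self _ _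
      have hb2m : b.2 ∈ insert a.1 (insert a.2 B) :=
        hE ▸ Finset.mem_insert_of_mem (Finset.mem_insert_self _ _)
      rw [Finset.mem_insert, Finset.mem_insert] at hb1m hb2m
      constructor
      · rcases hb1m with h | h | h
        · exact h.symm
        · exact absurd (h ▸ hb1.1) ha2.2
        · exact absurd h hb1.2
      · rcases hb2m with h | h | h
        · exact absurd (h ▸ ha1.1) hb2.2
        · exact h.symm
        · exact absurd (subset_clF_self hBg h) hb2.2
    obtain ⟨h1, h2⟩ := key yx yx' hyx.1 hyx.2 hyx'.1 hyx'.2 hEq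
    exact Prod.ext h1 h2
  have hval1 : ∑ S ∈ img1, wStaged M B S = ∑ x ∈ outer M B, (rb M B x + take M B x) := by
    rw [himg1, Finset.sum_image hinj1]
    apply Finset.sum_congr rfl
    intro x hx
    exact wStaged_insert hB3 hd (fun h => (mem_outer.mp hx).2 (subset_clF_self hBg h))
  have hval2 : ∑ S ∈ img2, wStaged M B S = ∑ x ∈ outer M B, ovf M B x := by
    rw [himg2, Finset.sum_image hinj2]
    rw [Finset.sum_product_right]
    apply Finset.sum_congr rfl
    intro x hx
    have hx' := mem_outer.mp hx
    have hterm : ∀ y ∈ inner M B, wStaged M B (insert y (insert x B)) = ovf M B x / ((inner M B).card : ℚ) := by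
      intro y hy
      have hy' := mem_inner.mp hy
      exact wStaged_insert_insert hBg hB3 hd hy'.1 hy'.2 hx'.2
    rw [Finset.sum_congr rfl hterm, Finset.sum_const, nsmul_eq_mul]
    rcases Finset.eq_empty_or_nonempty (inner M B) with hE | hne
    · rw [hE, ovf_eq_zero_of_inner_empty hBg hE]; simp
    · have hpos : (0 : ℚ) < (inner M B).card := by exact_mod_cast Finset.card_pos.mpr hne
      field_simp
  have hge : ∑ S ∈ img1 ∪ img2, wStaged M B S ≤ ∑ S ∈ rng, wStaged M B S := by
    apply Finset.sum_le_sum_of_subset_of_nonneg (Finset.union_subset hsub1 hsub2)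
    intro S _ _
    exact wStaged_nonneg B S
  rw [Finset.sum_union hdisj, hval1, hval2] at hge
  have hsum : ∑ x ∈ outer M B, (rb M B x + take M B x) + ∑ x ∈ outer M B, ovf M B x
      = ∑ x ∈ outer M B, rb M B x + (jB M B : ℚ) := by
    rw [← Finset.sum_add_distrib]
    have : ∀ x ∈ outer M B, rb M B x + take M B x + ovf M B x = rb M B x + jsh M B := by
      intro x _; unfold ovf; ring
    rw [Finset.sum_congr rfl this, Finset.sum_add_distrib, Finset.sum_const, nsmul_eq_mul]
    unfold jsh
    have hne := outer_nonempty hB3 hd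
    have hpos : (0 : ℚ) < (outer M B).card := by exact_mod_cast Finset.card_pos.mpr hne
    field_simp
  rw [hsum] at hge
  have hrb := sum_rb_ge (M := M) B
  have hfj : (fB M B : ℚ) + (jB M B : ℚ) = (crk M B : ℚ) := by
    unfold jB
    have := fB_le_crk (M := M) hBg
    push_cast [Nat.cast_sub this]
    ring
  linarith

/-- `S ∖ x` for a demanding coloop `x` of a rank-`4` set `S ⊆ gr M` is a rank-`3` subset of `S`. -/
theorem erase_mem_range {S : Finset α} (hS : S ∈ Shadow.levelSet M 4) {x : α} (hx : x ∈ dcol M S) :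
    S.erase x ∈ (Profile.Rq M 3).filter (fun B => B ⊆ S) := by
  rw [Profile.mem_levelSet] at hS
  rw [mem_dcol] at hx
  rw [Finset.mem_filter, Profile.mem_Rq]
  exact ⟨⟨(Finset.erase_subset _ _).trans hS.1, rkN_eq_iff.mp hx.2.1⟩, Finset.erase_subset _ _⟩

/-- `S ∖ {y, x}` for an `Ls`-pair `(y, x)` of a rank-`4` set `S ⊆ gr M` is a rank-`3` subset of `S`. -/
theorem erase_erase_mem_range {S : Finset α} (hS : S ∈ Shadow.levelSet M 4) {yx : α × α}
    (hyx : yx ∈ lsPairs M S) :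
    (S.erase yx.1).erase yx.2 ∈ (Profile.Rq M 3).filter (fun B => B ⊆ S) := by
  rw [Profile.mem_levelSet] at hS
  rw [mem_lsPairs] at hyx
  rw [Finset.mem_filter, Profile.mem_Rq]
  have hsub : (S.erase yx.1).erase yx.2 ⊆ S := (Finset.erase_subset _ _).trans (Finset.erase_subset _ _)
  exact ⟨⟨hsub.trans hS.1, rkN_eq_iff.mp hyx.2.2.1⟩, hsub⟩

/-- **The load of a rank-`4` set**: `Σ_{B ⊆ S, ρ(B) = 3} wStaged B S = rigid S + Σ_{x ∈ dcol S} take (S ∖ x) x`. -/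
theorem sum_wStaged_eq {S : Finset α} (hS : S ∈ Shadow.levelSet M 4) :
    ∑ B ∈ (Profile.Rq M 3).filter (fun B => B ⊆ S), wStaged M B S =
      rigid M S + ∑ x ∈ dcol M S, take M (S.erase x) x := by
  unfold wStaged
  rw [Finset.sum_add_distrib, Finset.sum_comm, Finset.sum_comm (s := (Profile.Rq M 3).filter (fun B => B ⊆ S))]
  have h1 : ∀ x ∈ dcol M S,
      (∑ B ∈ (Profile.Rq M 3).filter (fun B => B ⊆ S), if B = S.erase x then rb M B x + take M B x else 0)
        = rb M (S.erase x) x + take M (S.erase x) x := by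
    intro x hx
    rw [Finset.sum_ite_eq', if_pos (erase_mem_range hS hx)]
  have h2 : ∀ yx ∈ lsPairs M S,
      (∑ B ∈ (Profile.Rq M 3).filter (fun B => B ⊆ S),
        if B = (S.erase yx.1).erase yx.2 then ovf M B yx.2 / ((inner M B).card : ℚ) else 0)
        = ovf M ((S.erase yx.1).erase yx.2) yx.2 / ((inner M ((S.erase yx.1).erase yx.2)).card : ℚ) := by
    intro yx hyx
    rw [Finset.sum_ite_eq', if_pos (erase_erase_mem_range hS hyx)]
  rw [Finset.sum_congr rfl h1, Finset.sum_congr rfl h2, rigid_eq, Finset.sum_add_distrib]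
  ring

/-- **(Cap) by construction**: if `rigid S ≤ 4` then the normalised load of `S` is at most `1`. -/
theorem cap_wN_of_rigid {S : Finset α} (hS : S ∈ Shadow.levelSet M 4) (hr : rigid M S ≤ 4) :
    ∑ B ∈ (Profile.Rq M 3).filter (fun B => B ⊆ S), wN M B S ≤ 1 := by
  unfold wN
  rw [← Finset.sum_div, sum_wStaged_eq hS]
  rw [div_le_one (by norm_num)]
  have htake : ∑ x ∈ dcol M S, take M (S.erase x) x ≤ 4 - rigid M S := by
    have hle : ∀ x ∈ dcol M S, take M (S.erase x) x ≤ allow M S := by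
      intro x hx
      have hxS : x ∈ S := (mem_dcol.mp hx).1
      have := take_le_allow (M := M) (S.erase x) x
      rwa [Finset.insert_erase hxS] at this
    calc ∑ x ∈ dcol M S, take M (S.erase x) x ≤ ∑ _x ∈ dcol M S, allow M S := Finset.sum_le_sum hle
      _ = ((dcol M S).card : ℚ) * allow M S := by rw [Finset.sum_const, nsmul_eq_mul]
      _ ≤ 4 - rigid M S := by
        unfold allow allowOf
        rcases Finset.eq_empty_or_nonempty (dcol M S) with hE | hne
        · rw [hE]; simp; linarith
        · have hpos : (0 : ℚ) < (dcol M S).card := by exact_mod_cast Finset.card_pos.mpr hne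
          rw [mul_div_cancel₀ _ hpos.ne']
          rw [max_eq_right (by linarith)]
  linarith

/-- **The rigid bound**: every rank-`4` set has rigid load at most `4` — the one open claim of the row `(3,4)`. -/
def RigidBound (M : Matroid α) [M.Finite] : Prop := ∀ S ∈ Shadow.levelSet M 4, rigid M S ≤ 4

/-- **THE ROW `(3,4)` OF `(Π)` MODULO THE RIGID BOUND**, for every finite matroid. -/
theorem profileIneq_three_four_of_rigid (M : Matroid α) [M.Finite] (hR : RigidBound M) :
    Profile.ProfileIneq M 3 4 :=
  profileIneq_of_cert 3 4 (wN M) (fun S hS => cap_wN_of_rigid hS (hR S hS)) (fun _ hB => dem_wN hB)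

/-- **THE HALL FORM `(H⁺_{3,4})` MODULO THE RIGID BOUND**, for every finite matroid. -/
theorem hallIneq_three_four_of_rigid (M : Matroid α) [M.Finite] (hR : RigidBound M) :
    Profile.HallIneq M 3 4 :=
  hallIneq_of_cert 3 4 (wN M) (fun B S => wN_nonneg B S) (fun S hS => cap_wN_of_rigid hS (hR S hS))
    (fun _ hB => dem_wN hB)

end Staged
end PercRepro
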